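import Summits.BirchSwinnertonDyer.BirchSwinnertonDyer.Theses.UniversalToricDescent
import Summits.BirchSwinnertonDyer.BirchSwinnertonDyer.Theorems.UniversalToricDescentRoadFFCpIntMemberTowerSelfDual
import Summits.BirchSwinnertonDyer.BirchSwinnertonDyer.Theorems.UniversalToricDescentSelfMuZeroAtThree
import Summits.BirchSwinnertonDyer.BirchSwinnertonDyer.Theorems.UniversalToricDescentTwinDecLocusCubeTest
import Literature.NumberTheory.EllipticCurves.Skinner2016.HidaCongruentMembers
import Literature.NumberTheory.EllipticCurves.NonEisensteinPrimeOfSurjective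
import Literature.NumberTheory.EllipticCurves.Castella2018.HidaMembersFramesSigmaCongruenceOddPrime
import Literature.NumberTheory.EllipticCurves.HeegnerPointsProofs
import Literature.NumberTheory.EllipticCurves.PastenValuationProductThm75ExplicitProofs
import HarnessLib

/-!
# Route `UniversalToricDescent`, ♭B column: ♭B′ `TwinWanFrameAtThreeMultTresT` (stmt-BirchSwinnertonDyer-27401) BY NAME from Hsieh Thm B,
# the WEIGHT-CONTROLLED member/frame supply and K1♯† (the self-dual re-type of K1-at-3) — S1 kernel† of PEN-RULING-27934-v1, part 3

Cell `bsd-wall` (run/shared/lean/pub/bsd-wall/), seat `bsd-wall-utd-p2` (lead prover g18, 2026-08-28); `--supports stmt-BirchSwinnertonDyer-27401`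
(helper). Theorems only (no definition, no named fact, no `sorry`).

## What this file proves and why

Vet `bsd-vet-utdR2` g3 RETURNED K1-at-3 (item 27934 `TwinMemberRationalInclusionAtThree`) as misstated — Selmer side over the
arithmetic-normalised member lattice against the CENTRAL-value frame — and the pen adopted the repair K1♯† (module ↦ the self-dual twist
`D.Δ.selfDualCofreeRepOver K`, p657158; weight clause `4·3^{m−1} ∣ k_m − 2`; confinement `1 ≤ m`, residually irreducible members;
text `utdK/SketchK1dag.lean` v2 fc46e6da7466964a). This file is the kernel that makes the restate(s) zero-red:

* §1 `(4)†` `twinWanFrameAtThreeMultTresT_of_thmB_of_allSplitWtMembersFrames_of_selfDualMemberRationalInclusion` — ♭B′ BY NAME from Hsieh Thm B,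
  the consumer-minimal member/frame statement WITH WEIGHT CONTROL `C_min†` (inline) and K1♯† (inline, the pen's text VERBATIM): p645093's (4)
  over the self-dual tower kernel `twin_exists_forall_C_pow_mul_mem_span_of_cpIntMemberTower_selfDual_of_isTorsion`.
* §2 `allSplitWtMembersFrames_of_nonsplitWtMembersFrames` — `C_min†` from the print-shaped weight-controlled fact† (`Castella2018.castella2020_thm211_members_frames_sigma_congruence_odd_nonsplit_wt`, p661135 = item 22593's Literature fact with ONE added
  conjunct `2(p−1)p^{m−1} ∣ k_m − 2` — the re-type 22593† of PEN-RULING-27934-v1 T0, BY NAME; (iii) vacuous over an all-split `K`, Heegner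
  residue supplied, rigidity sign discarded).
* §3 `(5)†` `twinWanFrameAtThreeMultTresT_of_thmB_of_nonsplitWtMembersFrames_of_selfDualMemberRationalInclusion` — ♭B′ from {Hsieh Thm B, fact† by name,
  K1♯†}: the branch the restate-robust glue 27935 takes once the pen restates 22593 ↦ 22593† and 27934 ↦ K1♯† (in that order).

WHY THE SUPPLY NEEDS THE WEIGHT CLAUSE (lead g18 finding): K1♯† says nothing about members with `4·3^{m−1} ∤ k_m − 2`, and
`HidaCongruentMember` records only `2 ∣ k − 2` plus trace congruences at good primes — members with `k_m ≡ 0 (mod 4)` (whose self-dual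
lattice is residually `E[3] ⊗ ω`, not `E[3]`) are legitimate members the unconstrained supply may return at every depth; no kernel step can
exclude them. Print supports the constrained supply: [Castella2020JIMJ, Thm. 2.11] specialises at every arithmetic weight of the Hida family
and [Castella2018Erratum, proof of Thm. 1.1 (a)(b)] needs exactly `k_m ≡ 2 (mod 2(p−1)p^{m−1})` for its self-dual `T_{g_m}`.
HONEST FRAMING: CONDITIONAL on {Hsieh Thm B PUBLISHED, fact† PUBLISHED reading, K1♯† RESEARCH (no engine in print at `p = 3`)};
items closed 0; BSD is proved for no curve.

References: [Castella2018Erratum] §2 (p. 2), Thm. 1.1 (iii)(iv), Lemma 2.1, proof of Thm. 1.1 (a)(b)(c) (p. 4); [Castella2020JIMJ] Def. 2.10,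
Thm. 2.11; [Skinner2016PacificMC] §2.6 (2-6-1), §3.1; [Hsieh2014] Thm. B; [JetchevSkinnerWan2017] §5.1.
-/

noncomputable section

set_option linter.dupNamespace false
set_option autoImplicit false

open scoped Classical

namespace Summit.BirchSwinnertonDyer.BirchSwinnertonDyer.Theorems.UniversalToricDescentTwinWanFrameAtThreeMultTresTAllSplitSelfDual

open PowerSeries WeierstrassCurve NumberField IsDedekindDomain Field
  Literature.NumberTheory.EllipticCurves
  Literature.NumberTheory.EllipticCurves.ModularForms
  Literature.NumberTheory.EllipticCurves.Rank1Residual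
  Literature.NumberTheory.EllipticCurves.BigGaloisRep
  Literature.NumberTheory.EllipticCurves.GreenbergSelmer
  Literature.NumberTheory.GaloisRepresentations
  Summit.BirchSwinnertonDyer.Rank1Residual.X11b
  Summit.BirchSwinnertonDyer.Rank1Residual.X11b.Halves
  Summit.BirchSwinnertonDyer.BirchSwinnertonDyer.Theorems.SchneiderFree
  Summit.BirchSwinnertonDyer.BirchSwinnertonDyer.Theorems.UniversalToricDescentTwinTorsionRankOne
  Summit.BirchSwinnertonDyer.BirchSwinnertonDyer.Theorems.UniversalToricDescentTwinDecLocus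

/-! ### §1 (4)†: ♭B′ from Hsieh Thm B + the weight-controlled consumer-minimal member/frame statement `C_min†` + K1♯† -/

set_option maxHeartbeats 800000 in
-- statement-sized binders over the big representation (as p645093); the proof is glue
/-- **♭B′ `TwinWanFrameAtThreeMultTresT` (stmt-BirchSwinnertonDyer-27401) BY NAME from Hsieh Thm B + the consumer-minimal odd-`p`
member/frame statement WITH WEIGHT CONTROL `C_min†` over an all-split `K` (inline: `C_min` of p645093 with the one extra conjunct
`2(p−1)p^{m−1} ∣ k_m − 2` on the member) + K1♯†** (the pen's restated K1-at-3 text `utdK/SketchK1dag.lean` v2 fc46e6da7466964a VERBATIM: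
depth `m ≥ 1`, weight clause `2(3−1)3^{m−1} ∣ k_m − 2`, residually irreducible members, Selmer side over the SELF-DUAL lattice
`D.Δ.selfDualCofreeRepOver K`). Proof = p645093's (4) with the self-dual tower kernel
`twin_exists_forall_C_pow_mul_mem_span_of_cpIntMemberTower_selfDual_of_isTorsion` and the weight clause threaded from the supply to K1♯† verbatim
(both spell it `2·((3:ℕ):ℤ)−1)·((3:ℕ):ℤ)^{m−1} ∣ k_m − 2`). CONDITIONAL on {Hsieh Thm B PUBLISHED, `C_min†` PUBLISHED reading of [Castella2020JIMJ Thm 2.11] +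
[Skinner2016 §2.6] at weights `≡ 2 (mod 2(p−1)p^{m−1})`, K1♯† RESEARCH}; nothing is booked; BSD is proved for no curve.
[cite: Hsieh2014, Thm. B p. 712] [cite: Castella2020JIMJ, §2 Def. 2.10, Thm. 2.11] [cite: Skinner2016PacificMC, §2.6 (2-6-1), §3.1 (a)(b) (p. 192)]
[cite: Castella2018Erratum, §2 (p. 2), Thm. 1.1 (iv), proof of Thm. 1.1 (a)(b)(c) (p. 4)] -/
theorem twinWanFrameAtThreeMultTresT_of_thmB_of_allSplitWtMembersFrames_of_selfDualMemberRationalInclusion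
    (hB : Hsieh2014.thmB_exists_isHsiehLFunction_coeff_norm_eq_one_unrPeriod_anyLevel)
    (hC : ∀ {p : ℕ} [Fact p.Prime] (ι : PadicAlgCl p ≃+* ℂ) (W : WeierstrassCurve ℚ) [W.IsElliptic]
      [W.IsGloballyMinimal] (K : Type) [Field K] [NumberField K]
      (𝔭 : HeightOneSpectrum (𝓞 K)) (κ : ZpExtension K p) (γ : absoluteGaloisGroup K)
      [Fact (κ.IsTopGenerator γ)] {N : ℕ} [NeZero N] {f : CuspForm (CongruenceSubgroup.Gamma0 N) 2}
      (_ : IsNewformOf W f),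
      W.conductorNorm ℤ = N → p ≠ 2 → Mult W p → 3 ≤ N / p → Irr W p →
      IsImaginaryQuadratic K → Odd (NumberField.discr K) → SatisfiesHeegnerHypothesis N K →
      ((Ideal.span {(p : ℤ)}).primesOver (𝓞 K)).ncard = 2 →
      ((p : ℕ) : 𝓞 K) ∈ 𝔭.asIdeal →
      (∀ (w : InfinitePlace K) (x : 𝓞 K), x ∈ 𝔭.asIdeal ↔ ‖ι.symm (w.embedding (x : K))‖ < 1) →
      κ.IsAnticyclotomic →
      ∀ (a : unrIntegers p →+* PadicComplexInt p) (j : ℤ_[p] →+* unrIntegers p),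
        (∀ x : unrIntegers p, ((a x : PadicComplexInt p) : ℂ_[p]) = (x : ℂ_[p])) →
        (∀ x : ℤ_[p], ((j x : unrIntegers p) : ℂ_[p]) = algebraMap ℚ_[p] ℂ_[p] (x : ℚ_[p])) →
      ∃ (ΩK : ℂ) (Ωp : (unrIntegers p)ˣ) (L : UnrSeries p),
        ΩK ≠ 0 ∧ IsBDPLFunction ι 𝔭 κ γ f ΩK ((Ωp : unrIntegers p) : ℂ_[p]) L ∧
        ∀ m : ℕ, 1 ≤ m →
          ∃ (D : Skinner2016.HidaCongruentMember W p m) (Qm : PowerSeries (PadicComplexInt p)),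
            (2 * ((p : ℤ) - 1) * (p : ℤ) ^ (m - 1)) ∣ D.k - 2 ∧
            (∀ x : coeffField D.g, ι (D.ι x) = (x : ℂ)) ∧
            SkinnerUrban2014.IsResiduallyIrreducible D.Δ ∧
            IsBDPLFunctionWtSigmaInt ι 𝔭 κ γ D.g (W.sigmaPlacesFinset p K) ΩK ((Ωp : unrIntegers p) : ℂ_[p]) Qm ∧
            Ideal.span {Qm} ⊔ Ideal.span {(PowerSeries.C (((p : ℕ) : PadicComplexInt p) ^ m))} =
              Ideal.span {PowerSeries.map a (L * PowerSeries.map j (W.sigmaEulerElement p K κ))} ⊔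
                Ideal.span {(PowerSeries.C (((p : ℕ) : PadicComplexInt p) ^ m))})
    (hK1 : ∀ (W' : WeierstrassCurve ℚ) [W'.IsElliptic] [W'.IsGloballyMinimal] (N' : ℕ) [NeZero N'] (K : Type) [Field K] [NumberField K] (Dt' : Literature.NumberTheory.EllipticCurves.ModularForms.ModularParametrizationData W' N'), Literature.NumberTheory.EllipticCurves.Rank1Residual.Mult W' 3 → W'.HasSurjectiveModNGaloisRep 3 → W'.conductorNorm ℤ = N' → Literature.NumberTheory.EllipticCurves.IsImaginaryQuadratic K → Literature.NumberTheory.EllipticCurves.SatisfiesHeegnerHypothesis N' K → Odd (NumberField.discr K) → ∀ (κ : Literature.NumberTheory.EllipticCurves.ZpExtension K 3), κ.IsAnticyclotomic → ∀ (γ : Field.absoluteGaloisGroup K) [Fact (κ.IsTopGenerator γ)] (𝔭 : IsDedekindDomain.HeightOneSpectrum (NumberField.RingOfIntegers K)), ((3 : ℕ) : NumberField.RingOfIntegers K) ∈ 𝔭.asIdeal → 𝔭.asIdeal.ramificationIdx (NumberField.RingOfIntegers ℚ) = 1 → 𝔭.asIdeal.inertiaDeg (NumberField.RingOfIntegers ℚ)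 = 1 → ∀ (𝔭' : IsDedekindDomain.HeightOneSpectrum (NumberField.RingOfIntegers K)), ((3 : ℕ) : NumberField.RingOfIntegers K) ∈ 𝔭'.asIdeal → 𝔭' ≠ 𝔭 → ∀ (ι' : PadicAlgCl 3 ≃+* ℂ), Summit.BirchSwinnertonDyer.BirchSwinnertonDyer.Theorems.SchneiderFree.BranchInducesPrime 3 ι' 𝔭 → ∀ (m : ℕ), 1 ≤ m → ∀ (D : Literature.NumberTheory.EllipticCurves.Skinner2016.HidaCongruentMember W' 3 m), (2 * (((3 : ℕ) : ℤ) - 1) * ((3 : ℕ) : ℤ) ^ (m - 1)) ∣ D.k - 2 → Literature.NumberTheory.EllipticCurves.SkinnerUrban2014.IsResiduallyIrreducible D.Δ → (∀ x : Literature.NumberTheory.EllipticCurves.ModularForms.coeffField D.g, ι' (D.ι x) = (x : ℂ)) → ∀ (b : Literature.NumberTheory.EllipticCurves.GreenbergSelmer.padicCoeffIntegers D.ι →+* 𝓞_ℂ_[3]), (∀ x, ((b x : 𝓞_ℂ_[3]) : ℂ_[3]) = algebraMap (PadicAlgCl 3) ℂ_[3] (Literature.NumberTheory.EllipticCurves.GreenbergSelmer.padicCoeffIntegers.toPadicAlgCl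 D.ι x)) → ∀ (ΩK : ℂ) (Ωp : (𝓞_ℂ_[3])ˣ) (Q : PowerSeries 𝓞_ℂ_[3]), ΩK ≠ 0 → Literature.NumberTheory.EllipticCurves.IsBDPLFunctionWtSigmaInt ι' 𝔭 κ γ D.g (W'.sigmaPlacesFinset 3 K) ΩK ((Ωp : 𝓞_ℂ_[3]) : ℂ_[3]) Q → ∀ [TopologicalSpace (PowerSeries (Literature.NumberTheory.EllipticCurves.GreenbergSelmer.padicCoeffIntegers D.ι))] [ContinuousSMul (PowerSeries (Literature.NumberTheory.EllipticCurves.GreenbergSelmer.padicCoeffIntegers D.ι)) (Literature.NumberTheory.EllipticCurves.BigRepModule (Literature.NumberTheory.EllipticCurves.GreenbergSelmer.padicCoeffIntegers D.ι) 3 (Literature.NumberTheory.EllipticCurves.GreenbergSelmer.Cofree D.Δ.selfDualRep (Literature.NumberTheory.EllipticCurves.GreenbergSelmer.padicCoeffField D.ι)))], Module.IsTorsion (PowerSeries (Literature.NumberTheory.EllipticCurves.GreenbergSelmer.padicCoeffIntegers D.ι)) (Literature.NumberTheory.EllipticCurves.BigGaloisRep.XBig κ (D.Δ.selfDualCofreeRepOver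 K) 𝔭' (↑(W'.sigmaPlacesFinset 3 K))) → ∃ e : ℕ, Ideal.span {(PowerSeries.C ((3 : ℕ) : 𝓞_ℂ_[3]) : PowerSeries 𝓞_ℂ_[3]) ^ e} * (Literature.NumberTheory.EllipticCurves.BigGaloisRep.XBig.charIdeal κ (D.Δ.selfDualCofreeRepOver K) 𝔭' (↑(W'.sigmaPlacesFinset 3 K))).map (PowerSeries.map b) ≤ Ideal.span {Q}) :
    Summit.BirchSwinnertonDyer.BirchSwinnertonDyer.Theses.UniversalToricDescent.TwinWanFrameAtThreeMultTresT := by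
  intro W' _ _ N' _ K _ _ Dt' hmult hsurj hN' hK hH hodd hndvd κ hκ γ _ 𝔭 h𝔭 he hf 𝔭' h𝔭' hne ι' hι'
  -- (dec) from the très-ramifié binder
  have hdec : ∀ Q : (W'.baseChange ℚ_[3]).toAffine.Point, 3 • Q = 0 → Q = 0 :=
    twin_dec_of_forall_not_cube W' hmult (forall_not_exists_pow_of_nonsplit_or_not_dvd W' (Or.inr hndvd))
  -- the odd-`p` member/frame statement's binders from ♭B′'s
  have hirr : Irr W' 3 := hasIrreducibleModPGaloisRep_of_hasSurjectiveModNGaloisRep W' 3 hsurj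
  have hM : 3 ≤ N' / 3 := by
    have h11 := Pasten2024.eleven_le_level Dt'
    omega
  have hsplit : ((Ideal.span {((3 : ℕ) : ℤ)}).primesOver (𝓞 K)).ncard = 2 :=
    ncard_primesOver_eq_two_of_degreeOne hK.1 h𝔭 he hf
  obtain ⟨ΩK, Ωp, L, hΩK, hL, hmem⟩ := hC ι' W' K 𝔭 κ γ Dt'.isNewformOf hN' (by decide) hmult hM hirr hK hodd hH hsplit h𝔭 hι'
    hκ (R1.unrToCpInt 3) (toUnr 3) (R1.coe_unrToCpInt 3) (coe_toUnr 3)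
  have hΩp' : (((Units.map (R1.unrToCpInt 3 : unrIntegers 3 →* 𝓞_ℂ_[3]) Ωp : (𝓞_ℂ_[3])ˣ) : 𝓞_ℂ_[3]) : ℂ_[3]) =
      ((Ωp : unrIntegers 3) : ℂ_[3]) := by
    rw [Units.coe_map, MonoidHom.coe_coe, R1.coe_unrToCpInt]
  have hΩp0 : ((Ωp : unrIntegers 3) : ℂ_[3]) ≠ 0 := fun h0 ↦
    Ωp.ne_zero ((ZeroMemClass.coe_eq_zero).mp h0)
  -- `μ(L) = 0` from Thm B (♭-witness moved across periods, p538896)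
  have hμL : ∃ i : ℕ, IsUnit (PowerSeries.coeff i L) := by
    obtain ⟨ΩK₁, Ωp₁, Q, hΩK₁, hΩp₁, hQ, hμQ⟩ :=
      Summit.BirchSwinnertonDyer.BirchSwinnertonDyer.Theorems.UniversalToricDescentSelfMuZero.self_exists_isBDPLFunctionInt_coeff_norm_eq_one
        hB W' N' K Dt' hsurj hK hH κ hκ γ 𝔭 h𝔭 he hf ι' hι'
    have hΩp₁0 : Ωp₁ ≠ 0 := fun h ↦ by rw [h, norm_zero] at hΩp₁; exact zero_ne_one hΩp₁
    obtain ⟨i, hi⟩ :=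
      Summit.BirchSwinnertonDyer.BirchSwinnertonDyer.Theorems.UniversalToricDescentFlatMuTransfer.exists_coeff_norm_eq_one_of_isBDPLFunctionInt_of_isBDPLFunction
        hK hκ Fact.out hΩK₁ hΩK hΩp₁0 hΩp0 hQ hL hμQ
    exact ⟨i, (unrIntegers.isUnit_iff_norm_eq_one _).mpr hi⟩
  refine ⟨ΩK, ((Ωp : unrIntegers 3) : ℂ_[3]), L, hΩK, hΩp0, hL, fun hT₀ ↦ ?_⟩
  refine twin_exists_forall_C_pow_mul_mem_span_of_cpIntMemberTower_selfDual_of_isTorsion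
    SkinnerUrban2014.prop323_XAc_equiv_XBigDecomp_holds W' N' K hmult hsurj hN' hK hH κ hκ γ 𝔭' h𝔭' hdec hT₀ L hμL
    fun m hm ↦ ?_
  exact (hmem m hm).elim fun D hD ↦ hD.elim fun Qm hQ ↦
    ⟨D, Qm, hQ.1, fun b hb hT ↦ hK1 W' N' K Dt' hmult hsurj hN' hK hH hodd κ hκ γ 𝔭 h𝔭 he hf 𝔭' h𝔭' hne ι' hι' m hm D
      hQ.1 hQ.2.2.1 hQ.2.1 b hb
      ΩK (Units.map (R1.unrToCpInt 3 : unrIntegers 3 →* 𝓞_ℂ_[3]) Ωp) Qm hΩK (hΩp' ▸ hQ.2.2.2.1) hT, hQ.2.2.2.2⟩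

/-! ### §2 The weight-controlled supply: print-shaped member/frame fact† ⟹ `C_min†` over an all-split `K` -/

/-- **The weight-controlled odd-`p` member/frame statement `C_min†` over an all-split `K` from the print-shaped fact†**
`Castella2018.castella2020_thm211_members_frames_sigma_congruence_odd_nonsplit_wt` (p661135 = item 22593's fact with ONE added conjunct
`2(p−1)p^{m−1} ∣ k_m − 2` inside `∃ D Qm, …`; the re-typed supply 22593† of PEN-RULING-27934-v1, BY NAME):
Castella's print hypothesis (iii) is vacuous over an all-split `K` (a multiplicative `q` divides `N`, hence splits), the Heegner residue
`∃ β, 4N ∣ β² − d_K` is `exists_dvd_sq_sub_discr_holds`, the rigidity-sign conjunct is discarded — p645093's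
`allSplitMembersFrames_of_nonsplitMembersFrames` with the weight conjunct carried along. Bookkeeping, proved.
[cite: Castella2018Erratum, Thm. 1.1 hyp. (iii) and proof (a)(b)(c) (p. 4)] [cite: Castella2020JIMJ, §2 Thm. 2.11] [cite: Gross1984, §3] -/
theorem allSplitWtMembersFrames_of_nonsplitWtMembersFrames
    (hC' : Castella2018.castella2020_thm211_members_frames_sigma_congruence_odd_nonsplit_wt) :
    ∀ {p : ℕ} [Fact p.Prime] (ι : PadicAlgCl p ≃+* ℂ) (W : WeierstrassCurve ℚ) [W.IsElliptic]
      [W.IsGloballyMinimal] (K : Type) [Field K] [NumberField K]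
      (𝔭 : HeightOneSpectrum (𝓞 K)) (κ : ZpExtension K p) (γ : absoluteGaloisGroup K)
      [Fact (κ.IsTopGenerator γ)] {N : ℕ} [NeZero N] {f : CuspForm (CongruenceSubgroup.Gamma0 N) 2}
      (_ : IsNewformOf W f),
      W.conductorNorm ℤ = N → p ≠ 2 → Mult W p → 3 ≤ N / p → Irr W p →
      IsImaginaryQuadratic K → Odd (NumberField.discr K) → SatisfiesHeegnerHypothesis N K →
      ((Ideal.span {(p : ℤ)}).primesOver (𝓞 K)).ncard = 2 →
      ((p : ℕ) : 𝓞 K) ∈ 𝔭.asIdeal →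
      (∀ (w : InfinitePlace K) (x : 𝓞 K), x ∈ 𝔭.asIdeal ↔ ‖ι.symm (w.embedding (x : K))‖ < 1) →
      κ.IsAnticyclotomic →
      ∀ (a : unrIntegers p →+* PadicComplexInt p) (j : ℤ_[p] →+* unrIntegers p),
        (∀ x : unrIntegers p, ((a x : PadicComplexInt p) : ℂ_[p]) = (x : ℂ_[p])) →
        (∀ x : ℤ_[p], ((j x : unrIntegers p) : ℂ_[p]) = algebraMap ℚ_[p] ℂ_[p] (x : ℚ_[p])) →
      ∃ (ΩK : ℂ) (Ωp : (unrIntegers p)ˣ) (L : UnrSeries p),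
        ΩK ≠ 0 ∧ IsBDPLFunction ι 𝔭 κ γ f ΩK ((Ωp : unrIntegers p) : ℂ_[p]) L ∧
        ∀ m : ℕ, 1 ≤ m →
          ∃ (D : Skinner2016.HidaCongruentMember W p m) (Qm : PowerSeries (PadicComplexInt p)),
            (2 * ((p : ℤ) - 1) * (p : ℤ) ^ (m - 1)) ∣ D.k - 2 ∧
            (∀ x : coeffField D.g, ι (D.ι x) = (x : ℂ)) ∧
            SkinnerUrban2014.IsResiduallyIrreducible D.Δ ∧
            IsBDPLFunctionWtSigmaInt ι 𝔭 κ γ D.g (W.sigmaPlacesFinset p K) ΩK ((Ωp : unrIntegers p) : ℂ_[p]) Qm ∧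
            Ideal.span {Qm} ⊔ Ideal.span {(PowerSeries.C (((p : ℕ) : PadicComplexInt p) ^ m))} =
              Ideal.span {PowerSeries.map a (L * PowerSeries.map j (W.sigmaEulerElement p K κ))} ⊔
                Ideal.span {(PowerSeries.C (((p : ℕ) : PadicComplexInt p) ^ m))} := by
  intro p _ ι W _ _ K _ _ 𝔭 κ γ _ N _ f hf hN hp hmult hM hirr hK hodd hH hsplit h𝔭 hι hκ a j ha hj
  -- print (iii) is vacuous over an all-split `K`: a multiplicative `q` divides `N`, hence splits
  have hiii : ∀ (q : ℕ) [Fact q.Prime], Mult W q → ((Ideal.span {(q : ℤ)}).primesOver (𝓞 K)).ncard ≠ 2 →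
      ¬ W.HasSplitMultiplicativeReductionAtPrime q :=
    fun q _ hq hns _ ↦ hns (hH q Fact.out (hN ▸ dvd_conductorNorm_of_mult hq))
  -- the Heegner residue from the (strict) Heegner hypothesis
  have hβ : ∃ β : ℤ, (4 * N : ℤ) ∣ β ^ 2 - NumberField.discr K := exists_dvd_sq_sub_discr_holds N K hK hH
  obtain ⟨ΩK, Ωp, L, hΩK, hL, hmem⟩ := hC' ι W K 𝔭 κ γ hf hN hp hmult hM hirr hiii hK hodd hβ hsplit h𝔭 hι hκ a j ha hj
  exact ⟨ΩK, Ωp, L, hΩK, hL, fun m hm ↦ (hmem m hm).elim fun D hD ↦ hD.elim fun Qm hQ ↦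
    ⟨D, Qm, hQ.1, hQ.2.1, hQ.2.2.1, hQ.2.2.2.2.1, hQ.2.2.2.2.2⟩⟩

/-! ### §3 (5)†: ♭B′ from Hsieh Thm B + the print-shaped fact† + K1♯† — the kernel† of glue 27935 after the two restates -/

set_option maxHeartbeats 400000 in
/-- **♭B′ `TwinWanFrameAtThreeMultTresT` BY NAME from Hsieh Thm B (item 20711), the weight-controlled print-shaped member/frame fact†
`Castella2018.castella2020_thm211_members_frames_sigma_congruence_odd_nonsplit_wt` (p661135, the re-type 22593† BY NAME) and K1♯†
(the pen's intended re-type of item 27934, stated INLINE, `SketchK1dag.lean` v2 fc46e6da7466964a VERBATIM)** — the composition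
§1 ∘ §2 = kernel† `(5)†` of PEN-RULING-27934-v1: once the pen restates 22593 ↦ 22593† and 27934 ↦ K1♯†, glue 27935
«20711 → 22593† → K1♯† → ♭B′» is `fun hB hC hK ↦ (5)† hB hC hK`. CONDITIONAL on {PUBLISHED, PUBLISHED reading, K1♯† RESEARCH}; nothing
is booked; BSD is proved for no curve. [cite: Hsieh2014, Thm. B p. 712] [cite: Castella2020JIMJ, §2 Def. 2.10, Thm. 2.11]
[cite: Castella2018Erratum, §2 (p. 2), Thm. 1.1 hyp. (iii), proof (a)(b)(c) (p. 4)] -/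
theorem twinWanFrameAtThreeMultTresT_of_thmB_of_nonsplitWtMembersFrames_of_selfDualMemberRationalInclusion
    (hB : Hsieh2014.thmB_exists_isHsiehLFunction_coeff_norm_eq_one_unrPeriod_anyLevel)
    (hC' : Castella2018.castella2020_thm211_members_frames_sigma_congruence_odd_nonsplit_wt)
    (hK1 : ∀ (W' : WeierstrassCurve ℚ) [W'.IsElliptic] [W'.IsGloballyMinimal] (N' : ℕ) [NeZero N'] (K : Type) [Field K] [NumberField K] (Dt' : Literature.NumberTheory.EllipticCurves.ModularForms.ModularParametrizationData W' N'), Literature.NumberTheory.EllipticCurves.Rank1Residual.Mult W' 3 → W'.HasSurjectiveModNGaloisRep 3 → W'.conductorNorm ℤ = N' → Literature.NumberTheory.EllipticCurves.IsImaginaryQuadratic K → Literature.NumberTheory.EllipticCurves.SatisfiesHeegnerHypothesis N' K → Odd (NumberField.discr K) → ∀ (κ : Literature.NumberTheory.EllipticCurves.ZpExtension K 3), κ.IsAnticyclotomic → ∀ (γ : Field.absoluteGaloisGroup K) [Fact (κ.IsTopGenerator γ)] (𝔭 : IsDedekindDomain.HeightOneSpectrum (NumberField.RingOfIntegers K)),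 ((3 : ℕ) : NumberField.RingOfIntegers K) ∈ 𝔭.asIdeal → 𝔭.asIdeal.ramificationIdx (NumberField.RingOfIntegers ℚ) = 1 → 𝔭.asIdeal.inertiaDeg (NumberField.RingOfIntegers ℚ) = 1 → ∀ (𝔭' : IsDedekindDomain.HeightOneSpectrum (NumberField.RingOfIntegers K)), ((3 : ℕ) : NumberField.RingOfIntegers K) ∈ 𝔭'.asIdeal → 𝔭' ≠ 𝔭 → ∀ (ι' : PadicAlgCl 3 ≃+* ℂ), Summit.BirchSwinnertonDyer.BirchSwinnertonDyer.Theorems.SchneiderFree.BranchInducesPrime 3 ι' 𝔭 → ∀ (m : ℕ), 1 ≤ m → ∀ (D : Literature.NumberTheory.EllipticCurves.Skinner2016.HidaCongruentMember W' 3 m), (2 * (((3 : ℕ) : ℤ) - 1) * ((3 : ℕ) : ℤ) ^ (m - 1)) ∣ D.k - 2 → Literature.NumberTheory.EllipticCurves.SkinnerUrban2014.IsResiduallyIrreducible D.Δ → (∀ x : Literature.NumberTheory.EllipticCurves.ModularForms.coeffField D.g, ι' (D.ι x) = (x : ℂ)) → ∀ (b : Literature.NumberTheory.EllipticCurves.GreenbergSelmer.padicCoeffIntegers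 D.ι →+* 𝓞_ℂ_[3]), (∀ x, ((b x : 𝓞_ℂ_[3]) : ℂ_[3]) = algebraMap (PadicAlgCl 3) ℂ_[3] (Literature.NumberTheory.EllipticCurves.GreenbergSelmer.padicCoeffIntegers.toPadicAlgCl D.ι x)) → ∀ (ΩK : ℂ) (Ωp : (𝓞_ℂ_[3])ˣ) (Q : PowerSeries 𝓞_ℂ_[3]), ΩK ≠ 0 → Literature.NumberTheory.EllipticCurves.IsBDPLFunctionWtSigmaInt ι' 𝔭 κ γ D.g (W'.sigmaPlacesFinset 3 K) ΩK ((Ωp : 𝓞_ℂ_[3]) : ℂ_[3]) Q → ∀ [TopologicalSpace (PowerSeries (Literature.NumberTheory.EllipticCurves.GreenbergSelmer.padicCoeffIntegers D.ι))] [ContinuousSMul (PowerSeries (Literature.NumberTheory.EllipticCurves.GreenbergSelmer.padicCoeffIntegers D.ι)) (Literature.NumberTheory.EllipticCurves.BigRepModule (Literature.NumberTheory.EllipticCurves.GreenbergSelmer.padicCoeffIntegers D.ι) 3 (Literature.NumberTheory.EllipticCurves.GreenbergSelmer.Cofree D.Δ.selfDualRep (Literature.NumberTheory.EllipticCurves.GreenbergSelmer.padicCoeffField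 D.ι)))], Module.IsTorsion (PowerSeries (Literature.NumberTheory.EllipticCurves.GreenbergSelmer.padicCoeffIntegers D.ι)) (Literature.NumberTheory.EllipticCurves.BigGaloisRep.XBig κ (D.Δ.selfDualCofreeRepOver K) 𝔭' (↑(W'.sigmaPlacesFinset 3 K))) → ∃ e : ℕ, Ideal.span {(PowerSeries.C ((3 : ℕ) : 𝓞_ℂ_[3]) : PowerSeries 𝓞_ℂ_[3]) ^ e} * (Literature.NumberTheory.EllipticCurves.BigGaloisRep.XBig.charIdeal κ (D.Δ.selfDualCofreeRepOver K) 𝔭' (↑(W'.sigmaPlacesFinset 3 K))).map (PowerSeries.map b) ≤ Ideal.span {Q}) :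
    Summit.BirchSwinnertonDyer.BirchSwinnertonDyer.Theses.UniversalToricDescent.TwinWanFrameAtThreeMultTresT :=
  twinWanFrameAtThreeMultTresT_of_thmB_of_allSplitWtMembersFrames_of_selfDualMemberRationalInclusion hB
    (allSplitWtMembersFrames_of_nonsplitWtMembersFrames hC') hK1

end Summit.BirchSwinnertonDyer.BirchSwinnertonDyer.Theorems.UniversalToricDescentTwinWanFrameAtThreeMultTresTAllSplitSelfDual

end
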